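import Literature.MathematicalPhysics.QuantumFieldTheory.Balaban1983to89.B9Cor35GDirGStep
import Literature.MathematicalPhysics.QuantumFieldTheory.Balaban1983to89.B9Cor35GAtCubeLetters

/-!
# `Balaban1983to89.B9Cor35GDirAtCubeLetters` — [Balaban1985BackgroundPropagators] Corollary 3.5 p. 407 ∕ Theorem 3.4's `G`-CLAUSE FOR PRINT's DIRICHLET BOND
# CUBE LETTER `G_□ = (Ω₀(Δ_{loc,□} − DP_□D*)Ω₀)⁻¹` (p. 409 l. 3–5), THE (3.85)-MAJORANT `V·G_□(1) ≺ κα₁e^{−ρd}` FROM THE PIECES OF `V = 𝟙(T(1) − T(Ṽ))𝟙`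
# (Laplacian (3.69)–(3.73), projection (3.74)–(3.77), averaging (3.80)–(3.83)) AND THE ASSEMBLED `G`-STEP — r05's `B9Cor35GAtCubeLetters(FirstOrder)` RE-PRESSED
# AT THE DIRICHLET LETTERS, GENERIC IN THE `U`-FAMILY `T`, with the (C)-letter's split by letter — seat dag-n06-c g33, FILE 4 (road (B5))

statement-level skeleton of published theorems with citation tags; proofs where landed; nothing here is a claim about the Yang–Mills mass gap

CITATION HEADER (lean-in-tree rule).  B9 = T. Bałaban, *Propagators for lattice gauge theories in a background field*, Commun. Math. Phys. **99** (1985)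
389–434 [Balaban1985BackgroundPropagators] (held `paper:balaban1985-cmp99-background-propagators`; journal page = PDF page + 388): p. 407 (3.82)–(3.85)
«Δ_a(U′U) = … = Δ_a(U) − V₃(A) − P₁(A) − P₂(A). (3.82)  The operator V₃(A) is a local differential operator of the first order satisfying the bound (3.73). The
operator P₁(A) was defined in (3.76). It is a non-local bounded operator and satisfies the bound (3.77) … Using the bounds (3.73), (3.77), (3.83) and assuming
that Theorem 3.3 holds for G(U), we get |(V(A)G(U)J)(b)| ≦ O(1)α₁e^{−(1/2)δ₀d(y,y′)}|J| … (3.85)»; (3.69)–(3.77) pp. 404–406; Cor. 3.5 p. 407 l. 26–35; Thm 3.4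
p. 400; p. 409 l. 3–5 («G_□(U)»); p. 394 (Dirichlet conventions); p. 398 (scale transfer).  [4] = [Balaban1984PropagatorsII] Lemma 2.1 (2.61) p. 234, (2.52)–(2.55)
p. 232–233, (2.66) p. 234.  Rows B9.Cor3.5 × B9.Thm3.4 × B9.Eq3.85 (cells only; no row head changes).

WHY THIS FILE (director-ym №606 road (B5); dag-lead g46 WORDS 814/822; FILES 1–3 of this seat).  FILE 3 (`B9Cor35GDirGStep.gStep_dirB`) runs the `G`-step of Cor. 3.5
at the Dirichlet bond letters from ONE analytic input, the (3.85)-majorant `h385 : V·GiK(1) ≺ θe^{−ρd}` of the realified remainder `V = conj b(𝟙_B(T(1) − T(Ṽ))𝟙_B)`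
times the interior letter.  r05's `B9Cor35GAtCubeLetters.ineq385_op_dirs` is the LETTER-FREE (3.85) assembly ([4] (2.52)–(2.55) + Lemma 2.1 + p. 398's scale
transfer): pieces of the shapes (3.73) (`V⁰ + Σ_νV¹_ν∇_ν`), (3.77) (`P₁`), (3.83) (`P₂`) times a `G` with the (3.42)₁,₂ rows.  THIS FILE instantiates it at the
Dirichlet letters for ANY `U`-family `T`: the compression `𝟙_B(·)𝟙_B` costs nothing (`𝟙♯·X ≺ K` whenever `X ≺ K`; `𝟙♯·GiK = GiK`), so the pieces are those of the
UNCOMPRESSED difference `conj b((T(1) − T(Ṽ))♯)` (§2, hypothesis `hsplit`), and §3 assembles the `G`-step (FILE 3) with the constants of r05's G-F5.  §4 records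
the split BY LETTER for print's cube-levelled Dirichlet letter (C) `T U = Δ_{loc,□}(U) − DP_□(U)D*` (`B9Eq3105AtLetters.deltaLocCubeY − DPDsDirCubeY`, LOCATED-34):
Laplacian piece = r05's `lapPieceK` VERBATIM (letter-independent), projection piece `projPieceDirK` (the Dirichlet `P_□`), averaging piece `avgPieceCK` at a
generic bond transporter `parB` (`= avgPieceK` at def-Y's taxicab `parBY i` by `rfl`) — so that the landed producers (G-F5a/bridge II for the Laplacian piece, G-F5b
`B9Eq375GradDivSplitY`/`B9Ineq375GradDivBoundsY` for `D₁D*₁ − D_ṼD*_Ṽ`, G-F5c `hasMajorant_avgPieceK`) plug by name and only the Dirichlet `P₁`-word (the twin of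
G-F5c′ `cor35_POne_cube` at the Dirichlet site letter `G′_□`) remains to be produced.

WHAT IS PROVED (2 `def`s with bodies — `projPieceDirK`, `avgPieceCK`; theorems; 0 sorry; 0 new named facts; standard axioms):
* §1 `hasMajorant_projK_mul` (left compression by `𝟙♯` keeps any block majorant), `projK_mul_GiK`, `GiK_mul_projK`, `VdK_eq_projK_mul` (`V = 𝟙♯·conj b((T1 − TṼ)♯)·𝟙♯`),
  `VdK_mul_GiK_eq` (`V·GiK = 𝟙♯·(conj b((T1 − TṼ)♯)·GiK)`);
* §2 ★★`h385_dirB_of_pieces` (the (3.85)-majorant at the Dirichlet letters from the displayed split `hsplit` and piece majorants, FILE 2's rows, (2.61), transfers);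
* §3 ★★★`cor35_GDir_of_pieces` (FILE 3's `gStep_dirB` fed by §2: unit, padded + compressed (3.86) identities, left-entry transfer) and ★★`cor35_GDir_rows_of_pieces`
  (the three (3.42)-type rows of `GiK(Ṽ)`);
* §4 `projPieceDirK`, `avgPieceCK`, `avgPieceCK_parBY` (`rfl` to r05's), ★`dirB_split_C` (the (C)-letter's `conj b((T1 − TṼ)♯) = lapPieceK + projPieceDirK + avgPieceCK`).

HONEST SCOPE / NOT CLAIMED.  Assembly over landed modules (r05 G-F5 `ineq385_op_dirs`, r06's majorant calculus, FILES 2–3) — all BY NAME; nothing of [B9]'s analysis is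
asserted.  DISPLAYED (hypotheses): the split `hsplit` and the piece majorants `hV0 hV1 hPP hAv` (print (3.73)/(3.77)/(3.83); producers named above, the Dirichlet
`P₁`-word NOT yet in the tree), the `U = 1` rows `hG hDG` (FILE 2: conditional by name on `B6.Prop26DirichletPrinted`), (2.61) twice, two scale transfers, the located
smallness `κα₁c₁ < 1`, FILE 2's sockets `hT1 hKB`.  Right entries, Hölder ∕ `L²` members, Cor. 3.6 covariance: NOT here.  Nothing on `d = 4`, the continuum, reflection
positivity or the mass gap; NOT a node discharge; count-neutral; no row head changes.

RELATED IN THE TREE, NOT DUPLICATED: r05 `B9Cor35GAtCubeLetters` ∕ `…FirstOrder` (whole-torus letter; `ineq385_op_dirs`, `kappa385d`, `lapPieceK` USED BY NAME), r05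
`B9Cor35GCubeAvgPiece.avgPieceK` (taxicab instance of §4's `avgPieceCK`), my UNIT 2 `B9Cor35GpDirAtCubeLetters` (SITE Dirichlet letter), FILES 2–3.
-/

noncomputable section

namespace Literature.MathematicalPhysics.QuantumFieldTheory.Balaban1983to89.B9Cor35GDirAtCubeLetters

open Literature.MathematicalPhysics.QuantumFieldTheory.Balaban1983to89
open Literature.MathematicalPhysics.QuantumFieldTheory.Balaban1983to89.B6RandomWalk (HasMajorant BlockSupp hasMajorant_mono Ineq261 c1_nonneg)
open Literature.MathematicalPhysics.QuantumFieldTheory.Balaban1983to89.B9Thm34Ext (toB6)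
open Literature.MathematicalPhysics.QuantumFieldTheory.Balaban1983to89.B9Ineq347 (ScaleTransfer)
open Literature.MathematicalPhysics.QuantumFieldTheory.Balaban1983to89.B9Eq352DivFormLetters (conj conj_apply)
open Literature.MathematicalPhysics.QuantumFieldTheory.Balaban1983to89.B6KLevelCensusIndexV1 (KIdx)
open Literature.MathematicalPhysics.QuantumFieldTheory.Balaban1983to89.B6Cover236MultiLevelBlocks (cubes)
open Literature.MathematicalPhysics.QuantumFieldTheory.Balaban1983to89.B6GlobalChartV1L0 (blkV1)
open Literature.MathematicalPhysics.QuantumFieldTheory.Balaban1983to89.B9CubeLettersOpsL0 (cubeFamY)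
open Literature.MathematicalPhysics.QuantumFieldTheory.Balaban1983to89.B9CubeLettersBondOpsL0 (BlkCubeY QCubeY QsCubeY aCubeY)
open Literature.MathematicalPhysics.QuantumFieldTheory.Balaban1983to89.B9CubeGeometryInputs (geoCK geoCK_len_pos geoCK_dist_axioms)
open Literature.MathematicalPhysics.QuantumFieldTheory.Balaban1983to89.B9Cor35GCubeInputsAtOne (blkBK DK LapK)
open Literature.MathematicalPhysics.QuantumFieldTheory.Balaban1983to89.B9Cor36GpCubeEntriesAtV (conj_add')
open Literature.MathematicalPhysics.QuantumFieldTheory.Balaban1983to89.B9Cor35GAtCubeLetters (kappa385d kappa385d_nonneg ineq385_op_dirs lapPieceK)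
open Literature.MathematicalPhysics.QuantumFieldTheory.Balaban1983to89.B9Cor35GCubeAvgPiece (avgPieceK)
open Literature.MathematicalPhysics.QuantumFieldTheory.Balaban1983to89.B9Cor35GDirInputsAtOne (DadK GdK GiK)
open Literature.MathematicalPhysics.QuantumFieldTheory.Balaban1983to89.B9Cor35GDirGStep (VdK VdK_eq projK projK_mul_projK gStep_dirB gStep_dirB_rows)
open Literature.MathematicalPhysics.QuantumFieldTheory.Balaban1983to89.Node00 (SiteY FBondY CfgY BondParY toKT liftOpY parBY hessY gradY divY)
open Literature.MathematicalPhysics.QuantumFieldTheory.Balaban1983to89.Node00.OpsYLocalInverse (dirPadY dirInvY)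
open Literature.MathematicalPhysics.QuantumFieldTheory.Balaban1983to89.Node00.OpsYCubeDirInverseBond (indProjY indProjY_apply indProjY_mul_dirInvY dirInvY_mul_indProjY)
open Literature.MathematicalPhysics.QuantumFieldTheory.Balaban1983to89.Node00.OpsYCubeProjectionG (DPDsDirCubeY)
open scoped Matrix

variable {d ℓ : ℕ} {hd : 1 ≤ d + 1} {hL : Odd (ℓ + 1) ∧ 1 < ℓ + 1} {b₀ b₁ : ℝ}

/-! ## §1  Compression by `𝟙_B♯` costs nothing in the majorant calculus -/

section Compression

variable {𝔸 : Type} [NormedRing 𝔸] [NormedAlgebra ℂ 𝔸] [CompleteSpace 𝔸]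
variable {ι : Type} [Fintype ι] (b : Module.Basis ι ℝ 𝔸)
variable (i : KIdx d ℓ hd hL b₀ b₁) (q : ↥(cubes (toKT i).D.toDomains))

omit [CompleteSpace 𝔸] in
/-- `𝟙_B♯` acts coordinatewise: `(𝟙♯ μ)(b, j) = [b ∈ B]·μ(b, j)`. [cite: Balaban1985BackgroundPropagators, p.394 («Ω₀ denotes a characteristic function»), bookkeeping] -/
theorem projK_apply (B : Finset (FBondY i)) (μ : FBondY i × ι → ℝ) (p : FBondY i × ι) :
    projK b i B μ p = if p.1 ∈ B then μ p else 0 := by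
  rw [projK, conj_apply, LinearMap.restrictScalars_apply, indProjY_apply]
  split_ifs with h
  · rw [← B9Eq352DivFormLetters.coordEquiv_apply, LinearEquiv.apply_symm_apply]
  · simp

omit [CompleteSpace 𝔸] in
/-- ★ **LEFT COMPRESSION KEEPS A BLOCK MAJORANT**: `X ≺ K ⇒ 𝟙♯·X ≺ K` (the compression only zeroes entries). [cite: Balaban1984PropagatorsII, (2.51) p.232; Balaban1985BackgroundPropagators, p.394, bookkeeping] -/
theorem hasMajorant_projK_mul (B : Finset (FBondY i)) (Rr : ℝ) (H : Prop) {X : Module.End ℝ (FBondY i × ι → ℝ)} {K : BlkCubeY i q → BlkCubeY i q → ℝ}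
    (hX : HasMajorant (g := toB6 (geoCK i q) Rr H) (blkBK i q) X K) :
    HasMajorant (g := toB6 (geoCK i q) Rr H) (blkBK i q) (projK b i B * X) K := by
  intro y' μ C hμ p
  have h := hX y' μ C hμ p
  rw [Module.End.mul_apply, projK_apply]
  split_ifs
  · exact h
  · rw [abs_zero]; exact le_trans (abs_nonneg _) h

variable (T₁ : (FBondY i → 𝔸) →ₗ[ℂ] (FBondY i → 𝔸)) (B : Finset (FBondY i))

omit [CompleteSpace 𝔸] in
/-- `𝟙♯·GiK = GiK`. [cite: Balaban1985BackgroundPropagators, p.394 («Ω₀G′ = G′»), bookkeeping] -/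
theorem projK_mul_GiK : projK b i B * GiK b i T₁ B = GiK b i T₁ B := by
  rw [projK, GiK, ← B9Eq352DivFormLetters.conj_mul, Module.End.mul_eq_comp, ← LinearMap.restrictScalars_comp, ← Module.End.mul_eq_comp, indProjY_mul_dirInvY]

omit [CompleteSpace 𝔸] in
/-- `GiK·𝟙♯ = GiK`. [cite: Balaban1985BackgroundPropagators, p.394, bookkeeping] -/
theorem GiK_mul_projK : GiK b i T₁ B * projK b i B = GiK b i T₁ B := by
  rw [projK, GiK, ← B9Eq352DivFormLetters.conj_mul, Module.End.mul_eq_comp, ← LinearMap.restrictScalars_comp, ← Module.End.mul_eq_comp, dirInvY_mul_indProjY]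

variable (T : CfgY 𝔸 i → ((FBondY i → 𝔸) →ₗ[ℂ] (FBondY i → 𝔸))) (V : CfgY 𝔸 i)

/-- `V = 𝟙♯·conj b((T(1) − T(Ṽ))♯)·𝟙♯`. [cite: Balaban1985BackgroundPropagators, (3.84) p.407, p.394, bookkeeping] -/
theorem VdK_eq_projK_mul : VdK b i T B V = projK b i B * conj b ((T (fun _ _ => 1) - T V).restrictScalars ℝ) * projK b i B := by
  rw [VdK_eq, projK, ← B9Eq352DivFormLetters.conj_mul, ← B9Eq352DivFormLetters.conj_mul]
  rfl

/-- ★ `V·GiK(1) = 𝟙♯·(conj b((T(1) − T(Ṽ))♯)·GiK(1))` — the (3.85) product at the Dirichlet letters is the left compression of the UNCOMPRESSED pieces times the interior letter.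
[cite: Balaban1985BackgroundPropagators, (3.85) p.407, p.394, bookkeeping] -/
theorem VdK_mul_GiK_eq : VdK b i T B V * GiK b i (T (fun _ _ => 1)) B =
    projK b i B * (conj b ((T (fun _ _ => 1) - T V).restrictScalars ℝ) * GiK b i (T (fun _ _ => 1)) B) := by
  rw [VdK_eq_projK_mul, mul_assoc, mul_assoc, projK_mul_GiK]

end Compression

/-! ## §2  ★★ The (3.85)-majorant at the Dirichlet bond letters from the pieces -/

section H385

variable {𝔸 : Type} [NormedRing 𝔸] [NormedAlgebra ℂ 𝔸] [CompleteSpace 𝔸]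
variable {ι : Type} [Fintype ι] (b : Module.Basis ι ℝ 𝔸)
variable (i : KIdx d ℓ hd hL b₀ b₁) (q : ↥(cubes (toKT i).D.toDomains))
variable {T : CfgY 𝔸 i → ((FBondY i → 𝔸) →ₗ[ℂ] (FBondY i → 𝔸))} {B : Finset (FBondY i)}

/-- ★★ **THE (3.85)-MAJORANT `h385` OF `gStep_dirB` FROM THE PIECES** at the Dirichlet bond letters over `toB6 (geoCK i □) Rr H`: given FILE 2's `U = 1` rows
`GiK(1) ≺ B₀(Lⁿη)²e^{−δd}`, `∇_ν·GiK(1) ≺ B₀(Lⁿη)e^{−δd}`, a split of the UNCOMPRESSED remainder `conj b((T(1) − T(Ṽ))♯) = W⁰ + Σ_νW¹_ν∇_ν + P₁ + P₂` into first-order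
words with (3.73)-shaped majorants (`c_W`), a (3.77)-shaped word (`κ₁`) and a (3.83)-shaped word (`κ₂`), [4] (2.61) at `(δ₀, β)` and the p. 398 transfers at `(δ₀, α)` with
`ρ + (α+β)δ₀ ≦ δ`: `V·GiK(1) ≺ κα₁e^{−ρd}`, `κ = kappa385d B₀ c_W κ₁ κ₂ Λ c₁ (d+1)` (r05's constant).
[cite: Balaban1985BackgroundPropagators, (3.85) p.407, (3.73) p.405, (3.77) p.406, (3.83) p.407, Thm 3.3 p.399, p.409 l.3–5, p.398; Balaban1984PropagatorsII, Lemma 2.1 p.234, (2.52)–(2.55) p.232] -/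
theorem h385_dirB_of_pieces (Rr : ℝ) (H : Prop) (dB : ℕ) (δ₀ δ α β ρ Λ B₀ cW κ₁ κ₂ α₁ : ℝ)
    (hB₀ : 0 ≤ B₀) (hcW : 0 ≤ cW) (hκ₁ : 0 ≤ κ₁) (hκ₂ : 0 ≤ κ₂) (hα₁ : 0 ≤ α₁) (hΛ : 0 ≤ Λ) (hρ : 0 ≤ ρ)
    (hα : 0 ≤ α) (hβ : 0 ≤ β) (hδ₀ : 0 ≤ δ₀) (hr : ρ + (α + β) * δ₀ ≤ δ)
    (h261 : Ineq261 dB (toB6 (geoCK i q) Rr H) δ₀ β)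
    (hS1 : ScaleTransfer (geoCK i q) δ₀ α Λ (fun a => (geoCK i q).len a)) (hS2 : ScaleTransfer (geoCK i q) δ₀ α Λ (fun a => (geoCK i q).len a ^ 2))
    (V : CfgY 𝔸 i)
    (hG : HasMajorant (g := toB6 (geoCK i q) Rr H) (blkBK i q) (GiK b i (T (fun _ _ => 1)) B)
      (fun a a' => B₀ * (geoCK i q).len a ^ 2 * Real.exp (-(δ * (geoCK i q).dist a a'))))
    (hDG : ∀ ν, HasMajorant (g := toB6 (geoCK i q) Rr H) (blkBK i q) (DK b i ν * GiK b i (T (fun _ _ => 1)) B)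
      (fun a a' => B₀ * (geoCK i q).len a * Real.exp (-(δ * (geoCK i q).dist a a'))))
    {W0 PP AV : Module.End ℝ (FBondY i × ι → ℝ)} {W1 : Fin (d + 1) → Module.End ℝ (FBondY i × ι → ℝ)}
    (hsplit : conj b ((T (fun _ _ => 1) - T V).restrictScalars ℝ) = W0 + ∑ ν, W1 ν * DK b i ν + PP + AV)
    (hW0 : HasMajorant (g := toB6 (geoCK i q) Rr H) (blkBK i q) W0 (fun a a' => cW * α₁ * ((geoCK i q).len a ^ 2)⁻¹ * Real.exp (-(δ * (geoCK i q).dist a a'))))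
    (hW1 : ∀ ν, HasMajorant (g := toB6 (geoCK i q) Rr H) (blkBK i q) (W1 ν) (fun a a' => cW * α₁ * ((geoCK i q).len a)⁻¹ * Real.exp (-(δ * (geoCK i q).dist a a'))))
    (hPP : HasMajorant (g := toB6 (geoCK i q) Rr H) (blkBK i q) PP (fun a a' => κ₁ * α₁ * ((geoCK i q).len a ^ 2)⁻¹ * Real.exp (-(δ * (geoCK i q).dist a a'))))
    (hAv : HasMajorant (g := toB6 (geoCK i q) Rr H) (blkBK i q) AV (fun a a' => κ₂ * α₁ * ((geoCK i q).len a ^ 2)⁻¹ * Real.exp (-(δ * (geoCK i q).dist a a')))) :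
    HasMajorant (g := toB6 (geoCK i q) Rr H) (blkBK i q) (VdK b i T B V * GiK b i (T (fun _ _ => 1)) B)
      (fun a a' => kappa385d B₀ cW κ₁ κ₂ Λ (B6.c1 dB δ₀ β) (d + 1) * α₁ * Real.exp (-(ρ * (geoCK i q).dist a a'))) := by
  obtain ⟨hdnn, htri, -, -⟩ := geoCK_dist_axioms i q Rr H
  have h := ineq385_op_dirs (R := Rr) (H := H) (blkBK i q) dB δ₀ δ α β ρ Λ B₀ cW κ₁ κ₂ α₁ hB₀ hcW hκ₁ hκ₂ hα₁ hΛ hρ hα hβ hδ₀ hr hdnn htri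
    (geoCK_len_pos i q) h261 hS1 hS2 hW0 hW1 hPP hAv hG hDG
  rw [VdK_mul_GiK_eq, hsplit]
  refine hasMajorant_projK_mul b i q B Rr H ?_
  simpa [Fintype.card_fin] using h

end H385

/-! ## §3  ★★★ Cor. 3.5 ∕ Thm 3.4's `G`-clause at the Dirichlet bond letters, modulo the pieces -/

section Assembly

variable {𝔸 : Type} [NormedRing 𝔸] [NormedAlgebra ℂ 𝔸] [CompleteSpace 𝔸]
variable {ι : Type} [Fintype ι] (b : Module.Basis ι ℝ 𝔸)
variable (i : KIdx d ℓ hd hL b₀ b₁) (q : ↥(cubes (toKT i).D.toDomains))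
variable {T : CfgY 𝔸 i → ((FBondY i → 𝔸) →ₗ[ℂ] (FBondY i → 𝔸))} {B : Finset (FBondY i)} {M KB : Matrix (FBondY i) (FBondY i) ℝ}

/-- ★★★ **COROLLARY 3.5 ∕ THEOREM 3.4's `G`-CLAUSE FOR PRINT's DIRICHLET BOND CUBE LETTER, MODULO THE PIECES** (p. 407 «The theorems hold also for the operators (3.24),
(3.25) … with U = 1, these theorems were proved in [4]»; p. 409 l. 3–5): at any background `Ṽ` (meant the cut (3.37) field of the cube) — from FILE 2's `U = 1` sockets and
rows of the interior letter, the split of `conj b((T(1) − T(Ṽ))♯)` with its piece majorants (§2), [4] Lemma 2.1 at `(δ₀, β)` and at `(ρ, α′)`, the scale transfers and the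
located smallness `κα₁·c₁(ρ, α′) < 1`: (i) `padΔ(Ṽ) = 𝟙_B T(Ṽ) 𝟙_B + (1 − 𝟙_B)` IS A UNIT (so def-Y's `dirInvY 𝟙_B (T Ṽ)` is the genuine Dirichlet inverse); (ii) the
two padded resolvent identities of (3.86) and the COMPRESSED one `GiK(Ṽ) = GiK(1) + GiK(Ṽ)·(V·GiK(1))`; (iii) every left entry of `GiK(1)` at rate `ρ` transfers:
`X·GiK(Ṽ) ≺ B₀′c₁(1 − κα₁c₁)⁻¹P(y)e^{−(1−α′)ρd}`.
[cite: Balaban1985BackgroundPropagators, Cor. 3.5 p.407, Thm 3.4 p.400, (3.84)–(3.86) p.407, Thm 3.3 p.399, (3.42) p.397, p.409 l.3–5, p.394; Balaban1984PropagatorsII, Lemma 2.1 p.234, (2.66) p.234] -/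
theorem cor35_GDir_of_pieces (hT1 : T (fun _ _ => 1) = liftOpY 𝔸 M)
    (hKB : M.submatrix (fun v : ↥B => (v : FBondY i)) (fun v : ↥B => (v : FBondY i)) *
      KB.submatrix (fun v : ↥B => (v : FBondY i)) (fun v : ↥B => (v : FBondY i)) = 1)
    (Rr : ℝ) (H : Prop) (dB dB' : ℕ) (δ₀ δ α β ρ α' Λ B₀ cW κ₁ κ₂ α₁ : ℝ)
    (hB₀ : 0 ≤ B₀) (hcW : 0 ≤ cW) (hκ₁ : 0 ≤ κ₁) (hκ₂ : 0 ≤ κ₂) (hα₁ : 0 ≤ α₁) (hΛ : 0 ≤ Λ) (hρ : 0 ≤ ρ)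
    (hα : 0 ≤ α) (hβ : 0 ≤ β) (hδ₀ : 0 ≤ δ₀) (hr : ρ + (α + β) * δ₀ ≤ δ) (hα' : α' ≤ 1) (hα'ρ : 0 ≤ (1 - α') * ρ)
    (h261 : Ineq261 dB (toB6 (geoCK i q) Rr H) δ₀ β) (h261' : Ineq261 dB' (toB6 (geoCK i q) Rr H) ρ α')
    (hS1 : ScaleTransfer (geoCK i q) δ₀ α Λ (fun a => (geoCK i q).len a)) (hS2 : ScaleTransfer (geoCK i q) δ₀ α Λ (fun a => (geoCK i q).len a ^ 2))
    (hsmall : kappa385d B₀ cW κ₁ κ₂ Λ (B6.c1 dB δ₀ β) (d + 1) * α₁ * B6.c1 dB' ρ α' < 1)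
    (V : CfgY 𝔸 i)
    (hG : HasMajorant (g := toB6 (geoCK i q) Rr H) (blkBK i q) (GiK b i (T (fun _ _ => 1)) B)
      (fun a a' => B₀ * (geoCK i q).len a ^ 2 * Real.exp (-(δ * (geoCK i q).dist a a'))))
    (hDG : ∀ ν, HasMajorant (g := toB6 (geoCK i q) Rr H) (blkBK i q) (DK b i ν * GiK b i (T (fun _ _ => 1)) B)
      (fun a a' => B₀ * (geoCK i q).len a * Real.exp (-(δ * (geoCK i q).dist a a'))))
    {W0 PP AV : Module.End ℝ (FBondY i × ι → ℝ)} {W1 : Fin (d + 1) → Module.End ℝ (FBondY i × ι → ℝ)}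
    (hsplit : conj b ((T (fun _ _ => 1) - T V).restrictScalars ℝ) = W0 + ∑ ν, W1 ν * DK b i ν + PP + AV)
    (hW0 : HasMajorant (g := toB6 (geoCK i q) Rr H) (blkBK i q) W0 (fun a a' => cW * α₁ * ((geoCK i q).len a ^ 2)⁻¹ * Real.exp (-(δ * (geoCK i q).dist a a'))))
    (hW1 : ∀ ν, HasMajorant (g := toB6 (geoCK i q) Rr H) (blkBK i q) (W1 ν) (fun a a' => cW * α₁ * ((geoCK i q).len a)⁻¹ * Real.exp (-(δ * (geoCK i q).dist a a'))))
    (hPP : HasMajorant (g := toB6 (geoCK i q) Rr H) (blkBK i q) PP (fun a a' => κ₁ * α₁ * ((geoCK i q).len a ^ 2)⁻¹ * Real.exp (-(δ * (geoCK i q).dist a a'))))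
    (hAv : HasMajorant (g := toB6 (geoCK i q) Rr H) (blkBK i q) AV (fun a a' => κ₂ * α₁ * ((geoCK i q).len a ^ 2)⁻¹ * Real.exp (-(δ * (geoCK i q).dist a a')))) :
    IsUnit (dirPadY (indProjY B) (T V)) ∧
    (GdK b i (T V) B = GdK b i (T (fun _ _ => 1)) B + GdK b i (T (fun _ _ => 1)) B * VdK b i T B V * GdK b i (T V) B ∧
      GdK b i (T V) B = GdK b i (T (fun _ _ => 1)) B + GdK b i (T V) B * (VdK b i T B V * GdK b i (T (fun _ _ => 1)) B) ∧
      GiK b i (T V) B = GiK b i (T (fun _ _ => 1)) B + GiK b i (T V) B * (VdK b i T B V * GiK b i (T (fun _ _ => 1)) B)) ∧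
    ∀ (X : Module.End ℝ (FBondY i × ι → ℝ)) (B₀' : ℝ) (P : BlkCubeY i q → ℝ), 0 ≤ B₀' → (∀ y, 0 ≤ P y) →
      HasMajorant (g := toB6 (geoCK i q) Rr H) (blkBK i q) (X * GiK b i (T (fun _ _ => 1)) B)
        (fun a a' => B₀' * P a * Real.exp (-(ρ * (geoCK i q).dist a a'))) →
      HasMajorant (g := toB6 (geoCK i q) Rr H) (blkBK i q) (X * GiK b i (T V) B)
        (fun a a' => B₀' * B6.c1 dB' ρ α' * (1 - kappa385d B₀ cW κ₁ κ₂ Λ (B6.c1 dB δ₀ β) (d + 1) * α₁ * B6.c1 dB' ρ α')⁻¹ * P a *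
          Real.exp (-((1 - α') * ρ * (geoCK i q).dist a a'))) := by
  have h385 := h385_dirB_of_pieces b i q Rr H dB δ₀ δ α β ρ Λ B₀ cW κ₁ κ₂ α₁ hB₀ hcW hκ₁ hκ₂ hα₁ hΛ hρ hα hβ hδ₀ hr h261 hS1 hS2 V hG hDG hsplit hW0 hW1
    hPP hAv
  have hθ : 0 ≤ kappa385d B₀ cW κ₁ κ₂ Λ (B6.c1 dB δ₀ β) (d + 1) * α₁ := mul_nonneg (kappa385d_nonneg hB₀ hcW hκ₁ hκ₂ hΛ (c1_nonneg _ _ _)) hα₁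
  exact gStep_dirB b i q hT1 hKB Rr H dB' hθ hρ hα' hα'ρ h261' hsmall V h385

/-- ★★ **THE THREE (3.42)-TYPE ROWS OF THE INTERIOR DIRICHLET BOND LETTER AT `Ṽ`** (left entries `1`, `conj b(∇_ν)`, `conj b(Δ)`; FILE 2's `U = 1` rows at the transfer
rate `ρ`, constant `A ≧ 0`) under the hypotheses of `cor35_GDir_of_pieces`: `GiK(Ṽ) ≺ A c₁(1 − κα₁c₁)⁻¹(Lⁿη)²e^{−(1−α′)ρd}` etc.
[cite: Balaban1985BackgroundPropagators, Thm 3.4 p.400 («The extended operators satisfy all the inequalities of Theorems 3.1-3.3»), Cor. 3.5 p.407, (3.42) p.397, p.409 l.3–5] -/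
theorem cor35_GDir_rows_of_pieces (hT1 : T (fun _ _ => 1) = liftOpY 𝔸 M)
    (hKB : M.submatrix (fun v : ↥B => (v : FBondY i)) (fun v : ↥B => (v : FBondY i)) *
      KB.submatrix (fun v : ↥B => (v : FBondY i)) (fun v : ↥B => (v : FBondY i)) = 1)
    (Rr : ℝ) (H : Prop) (dB dB' : ℕ) (δ₀ δ α β ρ α' Λ B₀ cW κ₁ κ₂ α₁ : ℝ)
    (hB₀ : 0 ≤ B₀) (hcW : 0 ≤ cW) (hκ₁ : 0 ≤ κ₁) (hκ₂ : 0 ≤ κ₂) (hα₁ : 0 ≤ α₁) (hΛ : 0 ≤ Λ) (hρ : 0 ≤ ρ)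
    (hα : 0 ≤ α) (hβ : 0 ≤ β) (hδ₀ : 0 ≤ δ₀) (hr : ρ + (α + β) * δ₀ ≤ δ) (hα' : α' ≤ 1) (hα'ρ : 0 ≤ (1 - α') * ρ)
    (h261 : Ineq261 dB (toB6 (geoCK i q) Rr H) δ₀ β) (h261' : Ineq261 dB' (toB6 (geoCK i q) Rr H) ρ α')
    (hS1 : ScaleTransfer (geoCK i q) δ₀ α Λ (fun a => (geoCK i q).len a)) (hS2 : ScaleTransfer (geoCK i q) δ₀ α Λ (fun a => (geoCK i q).len a ^ 2))
    (hsmall : kappa385d B₀ cW κ₁ κ₂ Λ (B6.c1 dB δ₀ β) (d + 1) * α₁ * B6.c1 dB' ρ α' < 1)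
    (V : CfgY 𝔸 i)
    (hG : HasMajorant (g := toB6 (geoCK i q) Rr H) (blkBK i q) (GiK b i (T (fun _ _ => 1)) B)
      (fun a a' => B₀ * (geoCK i q).len a ^ 2 * Real.exp (-(δ * (geoCK i q).dist a a'))))
    (hDG : ∀ ν, HasMajorant (g := toB6 (geoCK i q) Rr H) (blkBK i q) (DK b i ν * GiK b i (T (fun _ _ => 1)) B)
      (fun a a' => B₀ * (geoCK i q).len a * Real.exp (-(δ * (geoCK i q).dist a a'))))
    {W0 PP AV : Module.End ℝ (FBondY i × ι → ℝ)} {W1 : Fin (d + 1) → Module.End ℝ (FBondY i × ι → ℝ)}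
    (hsplit : conj b ((T (fun _ _ => 1) - T V).restrictScalars ℝ) = W0 + ∑ ν, W1 ν * DK b i ν + PP + AV)
    (hW0 : HasMajorant (g := toB6 (geoCK i q) Rr H) (blkBK i q) W0 (fun a a' => cW * α₁ * ((geoCK i q).len a ^ 2)⁻¹ * Real.exp (-(δ * (geoCK i q).dist a a'))))
    (hW1 : ∀ ν, HasMajorant (g := toB6 (geoCK i q) Rr H) (blkBK i q) (W1 ν) (fun a a' => cW * α₁ * ((geoCK i q).len a)⁻¹ * Real.exp (-(δ * (geoCK i q).dist a a'))))
    (hPP : HasMajorant (g := toB6 (geoCK i q) Rr H) (blkBK i q) PP (fun a a' => κ₁ * α₁ * ((geoCK i q).len a ^ 2)⁻¹ * Real.exp (-(δ * (geoCK i q).dist a a'))))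
    (hAv : HasMajorant (g := toB6 (geoCK i q) Rr H) (blkBK i q) AV (fun a a' => κ₂ * α₁ * ((geoCK i q).len a ^ 2)⁻¹ * Real.exp (-(δ * (geoCK i q).dist a a'))))
    {A : ℝ} (hA : 0 ≤ A)
    (hGρ : HasMajorant (g := toB6 (geoCK i q) Rr H) (blkBK i q) (GiK b i (T (fun _ _ => 1)) B)
      (fun a a' => A * (geoCK i q).len a ^ 2 * Real.exp (-(ρ * (geoCK i q).dist a a'))))
    (hDGρ : ∀ ν, HasMajorant (g := toB6 (geoCK i q) Rr H) (blkBK i q) (DK b i ν * GiK b i (T (fun _ _ => 1)) B)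
      (fun a a' => A * (geoCK i q).len a * Real.exp (-(ρ * (geoCK i q).dist a a'))))
    (hLapGρ : HasMajorant (g := toB6 (geoCK i q) Rr H) (blkBK i q) (LapK b i * GiK b i (T (fun _ _ => 1)) B)
      (fun a a' => A * Real.exp (-(ρ * (geoCK i q).dist a a')))) :
    HasMajorant (g := toB6 (geoCK i q) Rr H) (blkBK i q) (GiK b i (T V) B)
        (fun a a' => A * B6.c1 dB' ρ α' * (1 - kappa385d B₀ cW κ₁ κ₂ Λ (B6.c1 dB δ₀ β) (d + 1) * α₁ * B6.c1 dB' ρ α')⁻¹ * (geoCK i q).len a ^ 2 *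
          Real.exp (-((1 - α') * ρ * (geoCK i q).dist a a'))) ∧
    (∀ ν, HasMajorant (g := toB6 (geoCK i q) Rr H) (blkBK i q) (DK b i ν * GiK b i (T V) B)
        (fun a a' => A * B6.c1 dB' ρ α' * (1 - kappa385d B₀ cW κ₁ κ₂ Λ (B6.c1 dB δ₀ β) (d + 1) * α₁ * B6.c1 dB' ρ α')⁻¹ * (geoCK i q).len a *
          Real.exp (-((1 - α') * ρ * (geoCK i q).dist a a')))) ∧
    HasMajorant (g := toB6 (geoCK i q) Rr H) (blkBK i q) (LapK b i * GiK b i (T V) B)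
        (fun a a' => A * B6.c1 dB' ρ α' * (1 - kappa385d B₀ cW κ₁ κ₂ Λ (B6.c1 dB δ₀ β) (d + 1) * α₁ * B6.c1 dB' ρ α')⁻¹ * 1 *
          Real.exp (-((1 - α') * ρ * (geoCK i q).dist a a'))) := by
  have h385 := h385_dirB_of_pieces b i q Rr H dB δ₀ δ α β ρ Λ B₀ cW κ₁ κ₂ α₁ hB₀ hcW hκ₁ hκ₂ hα₁ hΛ hρ hα hβ hδ₀ hr h261 hS1 hS2 V hG hDG hsplit hW0 hW1
    hPP hAv
  have hθ : 0 ≤ kappa385d B₀ cW κ₁ κ₂ Λ (B6.c1 dB δ₀ β) (d + 1) * α₁ := mul_nonneg (kappa385d_nonneg hB₀ hcW hκ₁ hκ₂ hΛ (c1_nonneg _ _ _)) hα₁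
  exact gStep_dirB_rows b i q hT1 hKB Rr H dB' hθ hρ hα' hα'ρ h261' hsmall V h385 hA hGρ (DK b i) hDGρ (LapK b i) hLapGρ

end Assembly

/-! ## §4  The split BY LETTER for print's cube-levelled Dirichlet letter (C): `T U = Δ_{loc,□}(U) − DP_□(U)D*` -/

section SplitC

variable {𝔸 : Type} [NormedRing 𝔸] [NormedAlgebra ℂ 𝔸] [CompleteSpace 𝔸]
variable {ι : Type} [Fintype ι] (b : Module.Basis ι ℝ 𝔸)
variable (i : KIdx d ℓ hd hL b₀ b₁) (q : ↥(cubes (toKT i).D.toDomains)) (parB : BondParY 𝔸 i) (S : Finset (SiteY i))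

/-- **the realified PROJECTION PIECE at the DIRICHLET projection `P_□ = G′_□Q′*_□C_□Q′_□G′_□` of the cube sequence**:
`conj b((D₁(1 − P_□(1))D*₁ − D_Ṽ(1 − P_□(Ṽ))D*_Ṽ)♯)` with def-Y's `DPDsDirCubeY i □ S` (the Dirichlet site letter `GpDirY`, blocks inside `S`).
[cite: Balaban1985BackgroundPropagators, (3.74)–(3.77) pp.405–406, (3.82) p.407, (3.25)–(3.26) pp.394–395, p.409 l.3–5] -/
def projPieceDirK (V : CfgY 𝔸 i) : Module.End ℝ (FBondY i × ι → ℝ) :=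
  conj b ((gradY i (fun _ _ => 1) ∘ₗ divY i (fun _ _ => 1) - DPDsDirCubeY i q S (fun _ _ => 1) - (gradY i V ∘ₗ divY i V - DPDsDirCubeY i q S V)).restrictScalars ℝ)

/-- **the realified AVERAGING PIECE of the cube sequence at a generic bond transporter** `conj b((Q*_□(1)a_□Q_□(1) − Q*_□(Ṽ)a_□Q_□(Ṽ))♯)` (r05's `avgPieceK` is the instance
at def-Y's taxicab transporters `parBY i`). [cite: Balaban1985BackgroundPropagators, (3.80)–(3.83) p.407, (3.26) p.395, p.409 l.3–5] -/
def avgPieceCK (V : CfgY 𝔸 i) : Module.End ℝ (FBondY i × ι → ℝ) :=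
  conj b ((QsCubeY i q parB 1 ∘ₗ aCubeY i q ∘ₗ QCubeY i q parB 1 - QsCubeY i q parB V ∘ₗ aCubeY i q ∘ₗ QCubeY i q parB V).restrictScalars ℝ)

/-- at def-Y's taxicab transporters the averaging piece IS r05's `avgPieceK`. [cite: Balaban1985BackgroundPropagators, (3.82) p.407, bookkeeping] -/
theorem avgPieceCK_parBY (V : CfgY 𝔸 i) : avgPieceCK b i q (parBY i) V = avgPieceK b i q V := rfl

/-- ★ **(3.82)∕(3.84) SPLIT BY LETTER AT PRINT's DIRICHLET BOND LETTER (C)**: for `T U := Δ_{loc,□}(U) − DP_□(U)D*` (`B9Eq3105AtLetters.deltaLocCubeY i □ parB U −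
DPDsDirCubeY i □ S U`), `conj b((T(1) − T(Ṽ))♯) = [Δ(1) − Δ(Ṽ)] + [D₁R_□(1)D₁* − D_ṼR_□(Ṽ)D*_Ṽ] + [Q*_□(1)aQ_□(1) − Q*_□(Ṽ)aQ_□(Ṽ)]` realified — r05's `lapPieceK`
VERBATIM, `projPieceDirK`, `avgPieceCK`. [cite: Balaban1985BackgroundPropagators, (3.82)–(3.84) p.407, (3.26) p.395, p.409 l.3–5] -/
theorem dirB_split_C (V : CfgY 𝔸 i) :
    conj b (((B9Eq3105AtLetters.deltaLocCubeY i q parB (fun _ _ => 1) - DPDsDirCubeY i q S (fun _ _ => 1)) -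
        (B9Eq3105AtLetters.deltaLocCubeY i q parB V - DPDsDirCubeY i q S V)).restrictScalars ℝ) =
      lapPieceK b i V + projPieceDirK b i q S V + avgPieceCK b i q parB V := by
  have e1 : (1 : CfgY 𝔸 i) = fun _ _ => 1 := rfl
  have e : (B9Eq3105AtLetters.deltaLocCubeY i q parB (fun _ _ => 1) - DPDsDirCubeY i q S (fun _ _ => 1)) -
        (B9Eq3105AtLetters.deltaLocCubeY i q parB V - DPDsDirCubeY i q S V) =
      (hessY i (fun _ _ => 1) - hessY i V) +
        (gradY i (fun _ _ => 1) ∘ₗ divY i (fun _ _ => 1) - DPDsDirCubeY i q S (fun _ _ => 1) - (gradY i V ∘ₗ divY i V - DPDsDirCubeY i q S V)) +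
        (QsCubeY i q parB 1 ∘ₗ aCubeY i q ∘ₗ QCubeY i q parB 1 - QsCubeY i q parB V ∘ₗ aCubeY i q ∘ₗ QCubeY i q parB V) := by
    rw [e1]; simp only [B9Eq3105AtLetters.deltaLocCubeY]; abel
  have e2 : (((B9Eq3105AtLetters.deltaLocCubeY i q parB (fun _ _ => 1) - DPDsDirCubeY i q S (fun _ _ => 1)) -
        (B9Eq3105AtLetters.deltaLocCubeY i q parB V - DPDsDirCubeY i q S V)).restrictScalars ℝ) =
      (hessY i (fun _ _ => 1) - hessY i V).restrictScalars ℝ +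
        (gradY i (fun _ _ => 1) ∘ₗ divY i (fun _ _ => 1) - DPDsDirCubeY i q S (fun _ _ => 1) -
          (gradY i V ∘ₗ divY i V - DPDsDirCubeY i q S V)).restrictScalars ℝ +
        (QsCubeY i q parB 1 ∘ₗ aCubeY i q ∘ₗ QCubeY i q parB 1 - QsCubeY i q parB V ∘ₗ aCubeY i q ∘ₗ QCubeY i q parB V).restrictScalars ℝ := by
    rw [e]; exact LinearMap.ext fun _ => rfl
  rw [lapPieceK, projPieceDirK, avgPieceCK, e2, conj_add', conj_add']

end SplitC

end Literature.MathematicalPhysics.QuantumFieldTheory.Balaban1983to89.B9Cor35GDirAtCubeLetters
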